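import Literature.Barriers.RiemannHypothesis.LiouvilleSignConjectures
import Literature.NumberTheory.LFunctions.RHWave0Proofs
import Literature.NumberTheory.LFunctions.LiouvilleOneSided
import HarnessLib

/-!
# Pólya's conjecture is false — unconditionally (proofs for `LiouvilleSignConjectures.lean`)

Sibling of `Literature/Barriers/RiemannHypothesis/LiouvilleSignConjectures.lean`, the barrier closing
**Pólya's conjecture** `∀ n ≥ 2, L(n) ≤ 0` (Mossinghoff–Trudgian 2012, §1, p. 158: "The assertion
that `L(x)` is never positive for `x ≥ 2` is often called 'Pólya's conjecture' in the literature,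
although it appears that Pólya never in fact stated this as a conjecture, at least not in print") —
the HYPOTHESIS of Pólya's 1919 criterion, i.e. the technique the barrier closes, not a result (the
barrier's former named def `Literature.Barriers.RiemannHypothesis.PolyaConjecture` for it is
deprecated — a refuted hypothesis is recorded by its `¬`-theorem, not as a named fact — and the
statement is spelled out below). That file refutes it only in hypothesis form
(`not_polyaConjecture_of_tanaka (h : Literature.NumberTheory.LFunctions.polya_conjecture_first_failure)`,
`not_polyaConjecture_of_tree (h : Literature.NumberTheory.LFunctions.not_polya_conjecture)`), deliberately
not importing the certified computation `Literature/NumberTheory/LFunctions/RHWave0Proofs.lean` (see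
its design notes). This file performs that import and records, without hypotheses, what the source
prints about Pólya's conjecture:

* `PolyaConjecture_false : ¬ ∀ n ≥ 2, L(n) ≤ 0` and `polyaConjecture_iff_false` — Pólya's conjecture
  is **false**. Source: "In 1958, Haselgrove [3] used the
  results of Ingham [4] to answer the first part of both problems, proving that both `L(x)` and
  `T(x)` change sign infinitely often … An explicit crossing point for `L(x)` was first computed by
  Lehman in 1960 [5], who found that `L(906 180 359) = 1`" (MT2012, §1, p. 158). The witness used
  is the tree's `Literature.RH.liouvilleSum_tanakaWitness : L(906 150 257) = 1` through
  `Literature.NumberTheory.LFunctions.not_polya_conjecture_holds`.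
* `polyaProblem_isLeast`, `polyaProblem_isLeast_real` — the second half of Mossinghoff–Trudgian's
  **Pólya's problem** ("Show that `L(x)` changes sign infinitely often, and determine the smallest
  `x ≥ 2` where `L(x) > 0`", §1, p. 158), as answered by Tanaka 1980: the least integer `n ≥ 2`
  (equivalently the least real `x ≥ 2`, `L` being a step function) with `L > 0` is `906 150 257`;
  from the tree's `Literature.NumberTheory.LFunctions.polya_conjecture_first_failure_holds`. (The first half, sign changes
  infinitely often, is Haselgrove's analytic theorem, vendored as the named fact
  `Haselgrove1958_signChanges` and not proved here.)

* `Polya1919_criterion_holds` — **Pólya's 1919 criterion itself is a theorem of the tree**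
  (discharge of the named fact `Polya1919_criterion`: eventual one-signedness of `L(n)` implies
  `RiemannHypothesis`), proved along the printed route (BFM 2008, §1, p. 1681: "This may be
  established by applying partial summation in (1) [`ζ(2s)/ζ(s) = ∑ λ(n) n^{-s}`] and then
  employing a well-known theorem of Landau on the convergence of Dirichlet series with terms of
  constant sign"): the tree's `Literature/NumberTheory/LFunctions/LiouvilleOneSided.lean` proves
  (1), the partial summation `∫_1^∞ L(x) x^{-(s+1)} dx = ζ(2s)/(sζ(s))` (Mathlib's
  `LSeries_eq_mul_integral'`), Landau's theorem for `L` under a one-sided bound `±L(x) ≤ A√x`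
  (`Literature.NumberTheory.LFunctions.integrableOn_liouville_rpow_of_oneSided`, from Landau's
  lemma for Mellin transforms of eventually one-signed functions, `LandauOscillation.lean`,
  MV Lemma 15.1) and the continuation `ζ ≠ 0` on `Re s > ½`
  (`Literature.NumberTheory.LFunctions.riemannZeta_ne_zero_of_liouville_integrable`); here the
  symmetry `ρ ↦ 1 − ρ` (`quasiRiemannHypothesis_one_half_iff_holds`) turns this into
  `RiemannHypothesis` (`riemannHypothesis_of_liouvilleSum_oneSided`, Ingham's one-sided form, RH
  part, BFM p. 1682), and eventual sign constancy over the integers is the one-sided bound with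
  `A = 0` (`L(x) = L(⌊x⌋)`). The proof is the genuine analytic one — it does NOT use the falsity
  of the hypothesis (Haselgrove's theorem `Haselgrove1958_signChanges` is a named fact) — and
  `Polya1919_criterion_holds` depends only on the three standard axioms.

## The numeral in the source

Mossinghoff–Trudgian print "Tanaka [9] showed that this occurs at `x = 906 105 257`" (§1,
p. 158). Tanaka 1980 (main result) and Borwein–Ferguson–Mossinghoff 2008 (§1, p. 1685: "In 1980,
Tanaka [17] determined that `n = 906 150 257` is the smallest integer `n > 1` for which
`L(n) = 1`") give `906 150 257`, and this is the value certified in the tree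
(`Literature.NumberTheory.LFunctions.polya_conjecture_first_failure_holds`: `0 < L(906150257)` and `L(n) ≤ 0` for all
`2 ≤ n < 906150257` — which in particular gives `L(906105257) ≤ 0`, see
`liouvilleSum_nonpos_MT2012numeral`). The two transposed digits in MT2012 are therefore a misprint;
the theorems below use `906 150 257`.

## Axioms

The two tree discharges are certified computations evaluated by `native_decide`, whose auxiliary
axioms (trust in the Lean compiler) are the only non-standard axioms here:
`PolyaConjecture_false`, `polyaConjecture_iff_false` and `liouvilleSum_tanaka_pos` depend on
`propext`, `Classical.choice`, `Quot.sound` and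
`Literature.NumberTheory.LFunctions.PolyaCounterexample.lsum_tanakaWitness._native.native_decide.ax_1_1` (the evaluation
`L(906150257) = 1`); the least-crossing theorems additionally on the 25 block axioms
`Literature.RH.LiouvilleSieve.checkChunk_00…23._native.native_decide.ax_1_1`,
`Literature.NumberTheory.LFunctions.LiouvilleSieve.checkLast_856._native.native_decide.ax_1_1` of the segmented sieve behind
`polya_conjecture_first_failure_holds` — exactly as the printed proofs (Lehman 1960, Tanaka 1980)
are machine computations (proposal flag `computational`).

## References

* [MossinghoffTrudgian2012] M. J. Mossinghoff, T. S. Trudgian, *Between the problems of Pólya and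
  Turán*, J. Aust. Math. Soc. 93 (2012), 157–171 — §1, p. 158 (read: Pólya's conjecture, Pólya's
  problem, Haselgrove/Lehman/Tanaka).
* [Tanaka1980] M. Tanaka, *A numerical investigation on cumulative sum of the Liouville function*,
  Tokyo J. Math. 3 (1980), 187–189 — main result (through `RHWave0Proofs.lean`).
* [BorweinFergusonMossinghoff2008] P. Borwein, R. Ferguson, M. J. Mossinghoff, *Sign changes in
  sums of the Liouville function*, Math. Comp. 77 (2008), 1681–1694 — §1, p. 1685 (read: the
  numeral `906 150 257`).
* [HaselgroveMathematika1958] C. B. Haselgrove, *A disproof of a conjecture of Pólya*,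
  Mathematika 5 (1958), 141–145 — p. 143.
* [MontgomeryVaughan2007] H. L. Montgomery, R. C. Vaughan, *Multiplicative Number Theory I*,
  CUP 2007 — §15.1 Lemma 15.1 (Landau), §15.1.1 Exercise 8 (a) (Ingham 1942: `Θ > ½ ⇒
  L(x) = Ω_±(x^{Θ−ε})`; read) (through `LiouvilleOneSided.lean`).
-/

noncomputable section

namespace Literature.Barriers.RiemannHypothesis

/-! ## Pólya's conjecture is false -/

/-- **Pólya's conjecture is false** (Haselgrove 1958; explicit witnesses Lehman 1960
`L(906 180 359) = 1`, Tanaka 1980 `L(906 150 257) = 1`): `∀ n ≥ 2, L(n) ≤ 0` fails —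
unconditionally, from the tree's certified `Literature.NumberTheory.LFunctions.not_polya_conjecture_holds`.
This is the `¬`-theorem recording the refuted hypothesis of the barrier (its former named def
`PolyaConjecture` is deprecated; the statement is spelled out). [cite: MossinghoffTrudgian2012, §1 (p. 158)]
[cite: HaselgroveMathematika1958, p. 143] [cite: Tanaka1980, main result] -/
theorem PolyaConjecture_false : ¬ ∀ n : ℕ, 2 ≤ n → Literature.NumberTheory.LFunctions.liouvilleSum n ≤ 0 :=
  not_polyaConjecture_of_tree Literature.NumberTheory.LFunctions.not_polya_conjecture_holds

/-- Pólya's conjecture `↔ False`: the hypothesis is refuted, so every criterion with this hypothesis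
(e.g. `Polya1919_criterion` restricted to it) holds only vacuously.
[cite: MossinghoffTrudgian2012, §1 (p. 158)] -/
theorem polyaConjecture_iff_false : (∀ n : ℕ, 2 ≤ n → Literature.NumberTheory.LFunctions.liouvilleSum n ≤ 0) ↔ False :=
  iff_false_intro PolyaConjecture_false

/-- Tanaka's witness in the integer form of Pólya's conjecture: `0 < L(906 150 257)`.
[cite: Tanaka1980, main result] -/
theorem liouvilleSum_tanaka_pos : 0 < Literature.NumberTheory.LFunctions.liouvilleSum ((906150257 : ℕ) : ℝ) := by
  rw [Nat.cast_ofNat, Literature.NumberTheory.LFunctions.liouvilleSum_tanakaWitness]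
  exact one_pos

/-! ## Pólya's problem (Mossinghoff–Trudgian 2012, §1), second half: the least crossing -/

/-- **Pólya's problem, second half** ("determine the smallest `x ≥ 2` where `L(x) > 0`",
Mossinghoff–Trudgian 2012, §1), answered by Tanaka 1980: `906 150 257` is the least integer
`n ≥ 2` with `L(n) > 0` (MT2012 print `906 105 257`, a transposition of two digits; see the module
docstring). From the tree's certified `Literature.NumberTheory.LFunctions.polya_conjecture_first_failure_holds`.
[cite: MossinghoffTrudgian2012, §1 (p. 158)] [cite: Tanaka1980, main result]
[cite: BorweinFergusonMossinghoff2008, §1 (p. 1685)] -/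
theorem polyaProblem_isLeast :
    IsLeast {n : ℕ | 2 ≤ n ∧ 0 < Literature.NumberTheory.LFunctions.liouvilleSum n} 906150257 := by
  refine ⟨⟨by norm_num, liouvilleSum_tanaka_pos⟩, fun n hn ↦ ?_⟩
  obtain ⟨h2, hpos⟩ := hn
  by_contra hlt
  exact absurd (Literature.NumberTheory.LFunctions.polya_conjecture_first_failure_holds.2 n h2 (not_le.1 hlt)) (not_le.2 hpos)

/-- The same over real `x ≥ 2` (`L` is a step function, `liouvilleSum_eq_floor`): `906 150 257` is
the least real `x ≥ 2` with `L(x) > 0`. [cite: MossinghoffTrudgian2012, §1 (p. 158)]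
[cite: Tanaka1980, main result] -/
theorem polyaProblem_isLeast_real :
    IsLeast {x : ℝ | 2 ≤ x ∧ 0 < Literature.NumberTheory.LFunctions.liouvilleSum x} 906150257 := by
  refine ⟨⟨by norm_num, Literature.NumberTheory.LFunctions.polya_conjecture_first_failure_holds.1⟩, fun x hx ↦ ?_⟩
  obtain ⟨h2, hpos⟩ := hx
  by_contra hlt
  rw [not_le] at hlt
  rw [liouvilleSum_eq_floor] at hpos
  have h0 : (0 : ℝ) ≤ x := by linarith
  have h2' : 2 ≤ ⌊x⌋₊ := Nat.le_floor (by exact_mod_cast h2)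
  have hlt' : ⌊x⌋₊ < 906150257 := (Nat.floor_lt h0).2 (by exact_mod_cast hlt)
  exact absurd (Literature.NumberTheory.LFunctions.polya_conjecture_first_failure_holds.2 _ h2' hlt') (not_le.2 hpos)

/-- In particular `L(n) ≤ 0` for every integer `2 ≤ n < 906 150 257`, so at MT2012's printed
numeral `906 105 257 (< 906 150 257)` one has `L ≤ 0`: the printed value cannot be a crossing
point. [cite: Tanaka1980, main result] [cite: MossinghoffTrudgian2012, §1 (p. 158)] -/
theorem liouvilleSum_nonpos_MT2012numeral : Literature.NumberTheory.LFunctions.liouvilleSum ((906105257 : ℕ) : ℝ) ≤ 0 :=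
  Literature.NumberTheory.LFunctions.polya_conjecture_first_failure_holds.2 906105257 (by norm_num) (by norm_num)

/-- Pólya's conjecture holds exactly on `2 ≤ n < 906 150 257` and fails at `906 150 257`: the
truncation `∀ n, 2 ≤ n → n < N → L(n) ≤ 0` holds iff `N ≤ 906 150 257`.
[cite: Tanaka1980, main result] -/
theorem polyaConjecture_below_iff (N : ℕ) :
    (∀ n : ℕ, 2 ≤ n → n < N → Literature.NumberTheory.LFunctions.liouvilleSum n ≤ 0) ↔ N ≤ 906150257 := by
  constructor
  · intro h
    by_contra hN
    exact absurd (h 906150257 (by norm_num) (not_le.1 hN)) (not_le.2 liouvilleSum_tanaka_pos)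
  · intro hN n h2 hn
    exact Literature.NumberTheory.LFunctions.polya_conjecture_first_failure_holds.2 n h2 (lt_of_lt_of_le hn hN)

/-! ## Pólya's 1919 criterion, discharged (BFM 2008, §1) -/

/-- **Ingham 1942, RH part, real-variable form (BFM 2008, §1, p. 1682: "the Riemann hypothesis …
follow[s] more generally if either `L(n) < c√n` or `L(n) > −c√n`, for some positive constant
`c`")**: a one-sided bound `η L(x) ≤ A√x` for all real `x ≥ x₁` (`η = ±1` selects the side; any
real `A`) implies the Riemann hypothesis. Landau's theorem (the tree's
`Literature.NumberTheory.LFunctions.integrableOn_liouville_rpow_of_oneSided`) gives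
`∫_1^∞ |L| x^{-σ-1} dx < ∞` for `σ > ½`, the representation `ζ(2s)/(sζ(s))` continues to
`Re s > ½` and shows `ζ ≠ 0` there
(`Literature.NumberTheory.LFunctions.riemannZeta_ne_zero_of_liouville_integrable`), and the
symmetry `ρ ↦ 1 − ρ` of the non-trivial zeros
(`Literature.NumberTheory.LFunctions.quasiRiemannHypothesis_one_half_iff_holds`) concludes.
[cite: BorweinFergusonMossinghoff2008, §1 (p. 1682)]
[cite: MontgomeryVaughan2007, §15.1.1 Exercise 8 (a)] -/
theorem riemannHypothesis_of_liouvilleSum_oneSided {A x₁ η : ℝ} (hη : η = 1 ∨ η = -1)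
    (hb : ∀ x, x₁ ≤ x → η * (Literature.NumberTheory.LFunctions.liouvilleSum x : ℝ) ≤ A * Real.sqrt x) :
    RiemannHypothesis :=
  Literature.NumberTheory.LFunctions.quasiRiemannHypothesis_one_half_iff_holds.mp fun _s hζ hs _ ↦
    Literature.NumberTheory.LFunctions.riemannZeta_ne_zero_of_liouville_integrable
      (fun _σ hσ ↦ Literature.NumberTheory.LFunctions.integrableOn_liouville_rpow_of_oneSided hη hb hσ)
      hs hζ

/-- **Pólya 1919 (as printed by BFM 2008, §1, p. 1681), case `L(n) ≤ 0` for all large `n`**: if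
`L(n) ≤ 0` for every integer `n ≥ N`, the Riemann hypothesis follows (the one-sided bound with
`η = 1`, `A = 0`, `x₁ = N`, since `L(x) = L(⌊x⌋)`). [cite: BorweinFergusonMossinghoff2008, §1 (p. 1681)] -/
theorem riemannHypothesis_of_liouvilleSum_eventually_nonpos {N : ℕ}
    (h : ∀ n : ℕ, N ≤ n → Literature.NumberTheory.LFunctions.liouvilleSum n ≤ 0) : RiemannHypothesis := by
  refine riemannHypothesis_of_liouvilleSum_oneSided (η := 1) (A := 0) (x₁ := N) (Or.inl rfl)
    fun x hx ↦ ?_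
  rw [one_mul, zero_mul, liouvilleSum_eq_floor]
  exact_mod_cast h _ (Nat.le_floor hx)

/-- **Pólya 1919 (as printed by BFM 2008, §1, p. 1681), case `L(n) ≥ 0` for all large `n`**: if
`0 ≤ L(n)` for every integer `n ≥ N`, the Riemann hypothesis follows (the one-sided bound with
`η = −1`, `A = 0`). [cite: BorweinFergusonMossinghoff2008, §1 (p. 1681)] -/
theorem riemannHypothesis_of_liouvilleSum_eventually_nonneg {N : ℕ}
    (h : ∀ n : ℕ, N ≤ n → 0 ≤ Literature.NumberTheory.LFunctions.liouvilleSum n) : RiemannHypothesis := by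
  refine riemannHypothesis_of_liouvilleSum_oneSided (η := -1) (A := 0) (x₁ := N) (Or.inr rfl)
    fun x hx ↦ ?_
  rw [zero_mul, liouvilleSum_eq_floor, neg_one_mul, neg_nonpos]
  exact_mod_cast h _ (Nat.le_floor hx)

/-- **Pólya 1919 (BFM 2008, §1, p. 1681): "the Riemann hypothesis follows if `L(n)` does not
change sign for sufficiently large `n`"** — the named fact `Polya1919_criterion`
(eventually `L(n) ≤ 0`, or eventually `L(n) ≥ 0`, implies `RiemannHypothesis`) PROVED, by the
printed route (partial
summation in `ζ(2s)/ζ(s) = ∑ λ(n) n^{-s}` and Landau's theorem for transforms of eventually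
one-signed functions; see the module docstring). [cite: BorweinFergusonMossinghoff2008, §1 (p. 1681)]
[cite: MontgomeryVaughan2007, §15.1 Lemma 15.1] -/
theorem Polya1919_criterion_holds : Polya1919_criterion := by
  rintro ⟨N, h | h⟩
  · exact riemannHypothesis_of_liouvilleSum_eventually_nonpos h
  · exact riemannHypothesis_of_liouvilleSum_eventually_nonneg h

/-- In particular Pólya's conjecture `∀ n ≥ 2, L(n) ≤ 0` itself would imply RH (non-vacuous form
of the first conjunct of `liouvilleRoutes_vacuous`, the case `N = 2` of
`riemannHypothesis_of_liouvilleSum_eventually_nonpos`; of course the hypothesis is false,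
`PolyaConjecture_false`). [cite: BorweinFergusonMossinghoff2008, §1 (p. 1681)] -/
theorem riemannHypothesis_of_polyaConjecture
    (h : ∀ n : ℕ, 2 ≤ n → Literature.NumberTheory.LFunctions.liouvilleSum n ≤ 0) : RiemannHypothesis :=
  riemannHypothesis_of_liouvilleSum_eventually_nonpos h

/-- **Ingham 1942, RH part, as printed (BFM 2008, §1, p. 1682)**: if `L(n) < c√n` for all large
integers `n`, or `L(n) > −c√n` for all large integers `n` (some real `c`), then the Riemann
hypothesis holds (`L` is a step function and `√⌊x⌋ ≤ √x`, so the integer bound gives the real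
one-sided bound with `A = |c|`). This is the RH conjunct of the named fact `Ingham1942_liouville`
under BFM's weaker one-sided hypothesis; the simplicity and linear-dependence conjuncts are not
proved here. [cite: BorweinFergusonMossinghoff2008, §1 (p. 1682)] -/
theorem riemannHypothesis_of_liouvilleSum_oneSided_nat {c : ℝ} {N : ℕ}
    (h : (∀ n : ℕ, N ≤ n → (Literature.NumberTheory.LFunctions.liouvilleSum n : ℝ) < c * Real.sqrt n) ∨
      (∀ n : ℕ, N ≤ n → -(c * Real.sqrt n) < Literature.NumberTheory.LFunctions.liouvilleSum n)) :
    RiemannHypothesis := by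
  rcases h with h | h
  · refine riemannHypothesis_of_liouvilleSum_oneSided (η := 1) (A := |c|) (x₁ := max N 1)
      (Or.inl rfl) fun x hx ↦ ?_
    have hx0 : 0 ≤ x := le_trans (by positivity) hx
    have hN : N ≤ ⌊x⌋₊ := Nat.le_floor ((le_max_left _ _).trans hx)
    have hfl : (⌊x⌋₊ : ℝ) ≤ x := Nat.floor_le hx0
    rw [one_mul, liouvilleSum_eq_floor]
    calc (Literature.NumberTheory.LFunctions.liouvilleSum (⌊x⌋₊ : ℕ) : ℝ)
        ≤ c * Real.sqrt (⌊x⌋₊ : ℕ) := (h _ hN).le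
      _ ≤ |c| * Real.sqrt (⌊x⌋₊ : ℕ) :=
          mul_le_mul_of_nonneg_right (le_abs_self c) (Real.sqrt_nonneg _)
      _ ≤ |c| * Real.sqrt x :=
          mul_le_mul_of_nonneg_left (Real.sqrt_le_sqrt hfl) (abs_nonneg c)
  · refine riemannHypothesis_of_liouvilleSum_oneSided (η := -1) (A := |c|) (x₁ := max N 1)
      (Or.inr rfl) fun x hx ↦ ?_
    have hx0 : 0 ≤ x := le_trans (by positivity) hx
    have hN : N ≤ ⌊x⌋₊ := Nat.le_floor ((le_max_left _ _).trans hx)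
    have hfl : (⌊x⌋₊ : ℝ) ≤ x := Nat.floor_le hx0
    rw [neg_one_mul, liouvilleSum_eq_floor, neg_le]
    calc -(|c| * Real.sqrt x) ≤ -(|c| * Real.sqrt (⌊x⌋₊ : ℕ)) :=
          neg_le_neg (mul_le_mul_of_nonneg_left (Real.sqrt_le_sqrt hfl) (abs_nonneg c))
      _ ≤ -(c * Real.sqrt (⌊x⌋₊ : ℕ)) :=
          neg_le_neg (mul_le_mul_of_nonneg_right (le_abs_self c) (Real.sqrt_nonneg _))
      _ ≤ (Literature.NumberTheory.LFunctions.liouvilleSum (⌊x⌋₊ : ℕ) : ℝ) := (h _ hN).le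

end Literature.Barriers.RiemannHypothesis
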